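import Literature.MathematicalPhysics.QuantumLattice.TorusGroundEnergyDensityLimit
import Literature.MathematicalPhysics.QuantumLattice.InfVolFermionStateBounds
import HarnessLib

/-!
# The BOX STATE: an infinite-volume fermion state restricted to the box `[0,L)^d` is a state of the
# WHOLE torus algebra of side `L` — variational principle, contractivity, interior translates,
# and the two-sided bookkeeping of a periodised Hamiltonian against the mean energy

Topic `Literature/MathematicalPhysics/QuantumLattice` (namespace = path; family `hubbard`). Companion of
`TorusGroundEnergyDensityLimit.lean` §3, whose proof of the box-state upper bound
`groundEnergy_le_pow_mul_re_expect_add` builds this functional INLINE and then discards it. The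
transplant lens of the Hubbard cuprate cell (`hubbard-cq`, DICTIONARY §12, step (ε) of the proof chain for the
pair-LRO ceiling `TIGroundStatePairLROCeiling`) needs the functional itself: a translation-invariant ground
state `ω`, restricted to the box and read as a torus state `φ_L`, is the trial state in Bogoliubov Jr.'s
zero-temperature approximating-Hamiltonian bound on the torus (`ApproximatingHamiltonianGroundEnergy.lean`),
so one needs `E₀(A) ≤ Re φ_L(A)` for arbitrary torus Hamiltonians `A`, the value of `φ_L` on interior
translates of a local observable, and `Re φ_L(H_L) ≤ L^d·Re ω(E) + O(L^{d-1})` at the level of `φ_L`.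
Everything is PROVED and MODEL-FREE (no Hamiltonian is fixed); one definition (`InfVolFermionState.boxState`),
no named fact, zero compute.

## Contents

* §1 `InfVolFermionState.boxState ω L` — the linear functional `X ↦ ω_{[0,L)^d}(relabel e⁻¹ X)` on the torus
  matrix algebra, `e` the box ≅ torus orbital bijection (`fermionEmbed_toTorusEmb_halfOpenBox_eq_relabel`):
  unital (`boxState_one`), positive (`boxState_nonneg`, `boxState_nonneg_of_nonneg`), Hermitian, contractive in
  the L²-operator norm (`norm_boxState_le`), and THE DEFINING PROPERTY `boxState_fermionEmbed_toTorusEmb`: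
  on the pull-back `Γ(ι_{Λ,L}) A` of a local observable `A ∈ 𝔄_Λ` with `Λ ⊆ [0,L)^d` it is `ω_Λ(A)`.
* §2 the variational principle `E₀(A) ≤ Re φ_L(A) ≤ −E₀(−A)` for Hermitian torus matrices
  (`groundEnergy_le_re_boxState`), and the linear form `E₀(A − c•B) ≤ Re φ_L(A) − c·Re φ_L(B)` used with
  `B = U⋆U` by the approximating-Hamiltonian chain (`groundEnergy_sub_smul_le_re_boxState`).
* §3 interior translates: `φ_L(T_{v mod L} Γ(ι_{Λ'}) E) = (ω ∘ τ_v)(E)` whenever `Λ' + v ⊆ [0,L)^d`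
  (`boxState_relabel_translate_fermionEmbed`), `= ω(E)` for translation-invariant `ω`; every translate is
  squeezed in `[E₀(E), −E₀(−E)]`.
* §4 THE PERIODISED HAMILTONIAN AT THE LEVEL OF `φ_L`: for `H = Σ_v T_v Γ(E) T_v⁻¹`, `Λ' ⊆ [−R,R]^d`, `2R ≤ L`
  and translation-invariant `ω`,
  `|Re φ_L(H) − L^d · Re ω(E)| ≤ (L^d − (L − 2R)^d) · (−E₀(−E) − E₀(E))`
  (`abs_re_boxState_sub_pow_mul_re_expect_le`; its upper half followed by the variational principle is the
  tree's `groundEnergy_le_pow_mul_re_expect_add`).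

## References
* O. Bratteli, D. W. Robinson, *Operator Algebras and Quantum Statistical Mechanics 2*, 2nd ed. (1997),
  §6.2.2 (periodic boxes: a state of the infinite system restricted to a box is a state of the torus algebra).
  [cite: BratteliRobinsonII1997, §6.2.2]
* O. Bratteli, D. W. Robinson, vol. 1 (1987), Prop. 2.3.11 (positive functionals: `‖ω‖ = ω(𝟙)`).
  [cite: BratteliRobinsonI1987, Prop. 2.3.11]
* H. Tasaki, *Physics and Mathematics of Quantum Many-Body Systems* (2020), §2.1 (variational principle).
  [cite: Tasaki2020, §2.1]
* N. N. Bogolubov Jr., Physica 32 (1966) 933, Thm. 1 (trial states in the approximating-Hamiltonian method).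
  [cite: Bogolubov1966, Theorem 1]
-/

noncomputable section

namespace Literature.MathematicalPhysics.QuantumLattice

open Matrix Finset HubbardWave0 Literature.Probability.LatticeModels _root_.Filter
open scoped _root_.Topology ComplexOrder BigOperators MatrixOrder

variable {d : ℕ}

/-! ### §1 The box state -/

section BoxState

variable (L : ℕ) [NeZero L]

/-- `relabel e 1 = 1`, generic rewriting form (at concrete orbital types `map_one` would have to
re-synthesise the matrix-algebra instances). [folklore] -/
private theorem relabel_one' {ι ι' : Type*} [LinearOrder ι] [Fintype ι] [LinearOrder ι'] [Fintype ι']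
    (e : ι ≃ ι') : relabel e (1 : Matrix (Finset ι) (Finset ι) ℂ) = 1 :=
  map_one (relabel e)

/-- `relabel e (−a) = −relabel e a`, generic rewriting form. [folklore] -/
private theorem relabel_neg' {ι ι' : Type*} [LinearOrder ι] [Fintype ι] [LinearOrder ι'] [Fintype ι']
    (e : ι ≃ ι') (a : Matrix (Finset ι) (Finset ι) ℂ) : relabel e (-a) = -relabel e a :=
  map_neg (relabel e) a

/-- The box ≅ torus ORBITAL bijection `Orb([0,L)^d) ≃ Orb((ℤ/Lℤ)^d)` induced by `x ↦ x mod L`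
(`bijective_toTorusEmb_halfOpenBox`); `Γ(ι_{[0,L)^d,L}) = relabel (boxOrbEquiv L)`
(`fermionEmbed_toTorusEmb_halfOpenBox_eq_relabel`). [cite: FriedliVelenik2017, §3.1] -/
def boxOrbEquiv : Orb (PolySite (halfOpenBox d L)) ≃ Orb (FermionTorus d L) :=
  Orb.mapEquiv (Equiv.ofBijective _ (bijective_toTorusEmb_halfOpenBox (d := d) L))

/-- `Γ(ι_{[0,L)^d,L}) A = relabel (boxOrbEquiv L) A` (the tree's
`fermionEmbed_toTorusEmb_halfOpenBox_eq_relabel`, renamed). [cite: BratteliRobinsonII1997, §5.2.2, Thm. 5.2.5] -/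
theorem fermionEmbed_toTorusEmb_halfOpenBox_eq_relabel_boxOrbEquiv (A : FermionOp (halfOpenBox d L)) :
    fermionEmbed (PolySite.toTorusEmb L (injOn_proj_halfOpenBox (d := d) L)) A = relabel (boxOrbEquiv L) A :=
  fermionEmbed_toTorusEmb_halfOpenBox_eq_relabel L A

namespace InfVolFermionState

variable (ω : InfVolFermionState d)

/-- **The BOX STATE** `φ_L` of an infinite-volume state `ω` on the torus of side `L`: the state `ω`
restricted to the box `[0,L)^d`, transported to the WHOLE matrix algebra of the fermionic torus along the
algebra isomorphism `𝔄_{[0,L)^d} ≅ End(Fock((ℤ/Lℤ)^d))` (`relabel (boxOrbEquiv L)`):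
`φ_L(X) = ω_{[0,L)^d}(relabel (boxOrbEquiv L)⁻¹ X)`. (Built by hand as a linear map: composing with
`(relabel _).toLinearMap` would make Lean compare two instance paths of the matrix algebra.)
[cite: BratteliRobinsonII1997, §6.2.2] -/
def boxState : Matrix (Finset (Orb (FermionTorus d L))) (Finset (Orb (FermionTorus d L))) ℂ →ₗ[ℂ] ℂ where
  toFun X := ω.expect (halfOpenBox d L) (relabel (boxOrbEquiv (d := d) L).symm X)
  map_add' X Y := by rw [relabel_add]; exact (ω.expect _).map_add _ _
  map_smul' a X := by rw [relabel_smul]; exact (ω.expect _).map_smul a _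

/-- `φ_L` unfolded. [cite: BratteliRobinsonII1997, §6.2.2] -/
theorem boxState_apply (X : Matrix (Finset (Orb (FermionTorus d L))) (Finset (Orb (FermionTorus d L))) ℂ) :
    ω.boxState L X = ω.expect (halfOpenBox d L) (relabel (boxOrbEquiv (d := d) L).symm X) := rfl

/-- `φ_L` on a relabelled box observable is the box expectation: `φ_L(relabel e A) = ω_{[0,L)^d}(A)`.
[cite: BratteliRobinsonII1997, §6.2.2] -/
theorem boxState_relabel_boxOrbEquiv (A : FermionOp (halfOpenBox d L)) :
    ω.boxState L (relabel (boxOrbEquiv L) A) = ω.expect (halfOpenBox d L) A := by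
  rw [boxState_apply, relabel_symm_relabel]

/-- **THE DEFINING PROPERTY**: on the pull-back `Γ(ι_{Λ,L}) A` of a local observable `A ∈ 𝔄_Λ` of a region
`Λ ⊆ [0,L)^d` INSIDE the box, the box state is the local expectation `ω_Λ(A)` (isotony `Λ ⊆ [0,L)^d`, then the
box isomorphism, then compatibility of `ω`). [cite: BratteliRobinsonII1997, §6.2.2] -/
theorem boxState_fermionEmbed_toTorusEmb {Λ : Finset (Site d)} (hΛ : Λ ⊆ halfOpenBox d L)
    (hInj : Set.InjOn (Torus.proj (d := d) L) ↑Λ) (A : FermionOp Λ) :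
    ω.boxState L (fermionEmbed (PolySite.toTorusEmb L hInj) A) = ω.expect Λ A := by
  have h1 : fermionEmbed (PolySite.toTorusEmb L hInj) A =
      fermionEmbed (PolySite.toTorusEmb L (injOn_proj_halfOpenBox (d := d) L))
        (fermionEmbed (PolySite.incl hΛ) A) := by
    rw [fermionEmbed_fermionEmbed]
    exact congrFun (congrArg DFunLike.coe (fermionEmbed_congr fun p => rfl)) A
  rw [h1, fermionEmbed_toTorusEmb_halfOpenBox_eq_relabel_boxOrbEquiv, boxState_relabel_boxOrbEquiv,
    ω.compatible hΛ]

/-- **`φ_L` is unital**: `φ_L(𝟙) = 1`. (The unit produced by the generic `relabel` lemma carries the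
order-derived `DecidableEq` instance of the torus orbitals, equal to the ambient one only propositionally —
hence the entrywise comparison.) [cite: BratteliRobinsonII1997, §6.2.2] -/
theorem boxState_one : ω.boxState L 1 = 1 := by
  have hg := relabel_one' (boxOrbEquiv (d := d) L)
  have e1 : (1 : Matrix (Finset (Orb (FermionTorus d L))) (Finset (Orb (FermionTorus d L))) ℂ) =
      relabel (boxOrbEquiv (d := d) L) (1 : FermionOp (halfOpenBox d L)) := by
    rw [hg]
    ext a b
    simp only [Matrix.one_apply]
    by_cases h : a = b
    · rw [if_pos h, if_pos h]
    · rw [if_neg h, if_neg h]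
  rw [e1, boxState_relabel_boxOrbEquiv, ω.expect_one]

/-- **`φ_L` is positive**: `φ_L(Xᴴ X) ≥ 0`. [cite: BratteliRobinsonII1997, §6.2.2] -/
theorem boxState_nonneg (X : Matrix (Finset (Orb (FermionTorus d L))) (Finset (Orb (FermionTorus d L))) ℂ) :
    0 ≤ ω.boxState L (Xᴴ * X) := by
  rw [boxState_apply, relabel_mul, relabel_conjTranspose]
  exact ω.expect_nonneg _ _

/-- `φ_L` is positive on the whole Loewner cone: `0 ≤ X → 0 ≤ φ_L(X)`.
[cite: BratteliRobinsonI1987, Def. 2.3.9] -/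
theorem boxState_nonneg_of_nonneg {X : Matrix (Finset (Orb (FermionTorus d L))) (Finset (Orb (FermionTorus d L))) ℂ}
    (hX : 0 ≤ X) : 0 ≤ ω.boxState L X := by
  rw [StarOrderedRing.nonneg_iff] at hX
  induction hX using AddSubmonoid.closure_induction with
  | mem x hx =>
    obtain ⟨B, rfl⟩ := hx
    exact ω.boxState_nonneg L B
  | zero => simp
  | add x y _ _ hx hy =>
    rw [map_add]
    exact add_nonneg hx hy

/-- `Re φ_L(X) ≥ 0` for positive semidefinite `X`. [cite: BratteliRobinsonI1987, Def. 2.3.9] -/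
theorem re_boxState_nonneg_of_posSemidef
    {X : Matrix (Finset (Orb (FermionTorus d L))) (Finset (Orb (FermionTorus d L))) ℂ} (hX : X.PosSemidef) :
    0 ≤ (ω.boxState L X).re :=
  (Complex.nonneg_iff.1 (ω.boxState_nonneg_of_nonneg L (Matrix.nonneg_iff_posSemidef.2 hX))).1

/-- **`φ_L` is Hermitian**: `φ_L(Xᴴ) = conj φ_L(X)`. [cite: BratteliRobinsonI1987, §2.3.2] -/
theorem boxState_conjTranspose (X : Matrix (Finset (Orb (FermionTorus d L))) (Finset (Orb (FermionTorus d L))) ℂ) :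
    ω.boxState L Xᴴ = star (ω.boxState L X) := by
  rw [boxState_apply, relabel_conjTranspose, ω.expect_conjTranspose, boxState_apply]

/-- For Hermitian `X`, `φ_L(X)` is real: `Im φ_L(X) = 0`. [cite: BratteliRobinsonI1987, §2.3.2] -/
theorem boxState_im_eq_zero_of_isHermitian
    {X : Matrix (Finset (Orb (FermionTorus d L))) (Finset (Orb (FermionTorus d L))) ℂ} (hX : X.IsHermitian) :
    (ω.boxState L X).im = 0 := by
  have h := ω.boxState_conjTranspose L X
  rw [hX.eq] at h
  have := congrArg Complex.im h
  rw [Complex.star_def, Complex.conj_im] at this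
  linarith

open scoped Matrix.Norms.L2Operator in
/-- **`φ_L` is contractive**: `‖φ_L(X)‖ ≤ ‖X‖` in the L²-operator norm (a unital positive functional on a
C⋆-algebra has norm `φ(𝟙) = 1`). [cite: BratteliRobinsonI1987, Prop. 2.3.11] -/
theorem norm_boxState_le (X : Matrix (Finset (Orb (FermionTorus d L))) (Finset (Orb (FermionTorus d L))) ℂ) :
    ‖ω.boxState L X‖ ≤ ‖X‖ := by
  letI : CStarAlgebra (Matrix (Finset (Orb (FermionTorus d L))) (Finset (Orb (FermionTorus d L))) ℂ) := {}
  exact Literature.MathematicalPhysics.QuantumLattice.PositiveLinearMap.norm_apply_le_of_map_one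
    (.mk₀ (ω.boxState L) fun _ hB => ω.boxState_nonneg_of_nonneg L hB) (ω.boxState_one L) X

open scoped Matrix.Norms.L2Operator in
/-- `|Re φ_L(X)| ≤ ‖X‖`. [cite: BratteliRobinsonI1987, Prop. 2.3.11] -/
theorem abs_re_boxState_le (X : Matrix (Finset (Orb (FermionTorus d L))) (Finset (Orb (FermionTorus d L))) ℂ) :
    |(ω.boxState L X).re| ≤ ‖X‖ :=
  (Complex.abs_re_le_norm _).trans (ω.norm_boxState_le L X)

/-! ### §2 The variational principle for the box state -/

/-- **VARIATIONAL PRINCIPLE**: `E₀(A) ≤ Re φ_L(A)` for every Hermitian torus matrix `A` — the box state is an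
admissible (mixed) trial state for every torus Hamiltonian. [cite: Tasaki2020, §2.1] -/
theorem groundEnergy_le_re_boxState
    {A : Matrix (Finset (Orb (FermionTorus d L))) (Finset (Orb (FermionTorus d L))) ℂ} (hA : A.IsHermitian) :
    A.groundEnergy ≤ (ω.boxState L A).re :=
  groundEnergy_le_re_of_state hA (ω.boxState L) (ω.boxState_one L) (ω.boxState_nonneg L)

/-- Upper companion: `Re φ_L(A) ≤ −E₀(−A)`. [cite: Tasaki2020, §2.1] -/
theorem re_boxState_le_neg_groundEnergy_neg
    {A : Matrix (Finset (Orb (FermionTorus d L))) (Finset (Orb (FermionTorus d L))) ℂ} (hA : A.IsHermitian) :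
    (ω.boxState L A).re ≤ -(-A).groundEnergy := by
  have h := ω.groundEnergy_le_re_boxState L hA.neg
  rw [map_neg, Complex.neg_re] at h
  linarith

/-- **The linear form used by the approximating-Hamiltonian chain**: for Hermitian `A`, `B` and real `c`,
`E₀(A − c•B) ≤ Re φ_L(A) − c · Re φ_L(B)` (variational principle + linearity; with `B = U⋆U` and
`c = V⁻¹` the left side is the ground energy of Bogoliubov Jr.'s model Hamiltonian `T − V⁻¹U⋆U`).
[cite: Bogolubov1966, Theorem 1] -/
theorem groundEnergy_sub_smul_le_re_boxState
    {A B : Matrix (Finset (Orb (FermionTorus d L))) (Finset (Orb (FermionTorus d L))) ℂ} (hA : A.IsHermitian)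
    (hB : B.IsHermitian) (c : ℝ) :
    (A - (c : ℂ) • B).groundEnergy ≤ (ω.boxState L A).re - c * (ω.boxState L B).re := by
  have hH : (A - (c : ℂ) • B).IsHermitian :=
    hA.sub (IsHermitian.smul hB (by rw [isSelfAdjoint_iff, Complex.star_def, Complex.conj_ofReal]))
  have h := ω.groundEnergy_le_re_boxState L hH
  rw [map_sub, LinearMap.map_smul, Complex.sub_re, smul_eq_mul, Complex.re_ofReal_mul] at h
  exact h

/-- The model-Hamiltonian instance: `E₀(T − c•(Uᴴ U)) ≤ Re φ_L(T) − c · Re φ_L(Uᴴ U)` for Hermitian `T`,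
any `U`, real `c`. [cite: Bogolubov1966, Theorem 1] -/
theorem groundEnergy_sub_smul_conjTranspose_mul_le_re_boxState
    {T : Matrix (Finset (Orb (FermionTorus d L))) (Finset (Orb (FermionTorus d L))) ℂ} (hT : T.IsHermitian)
    (U : Matrix (Finset (Orb (FermionTorus d L))) (Finset (Orb (FermionTorus d L))) ℂ) (c : ℝ) :
    (T - (c : ℂ) • (Uᴴ * U)).groundEnergy ≤ (ω.boxState L T).re - c * (ω.boxState L (Uᴴ * U)).re :=
  ω.groundEnergy_sub_smul_le_re_boxState L hT (isHermitian_conjTranspose_mul_self U) c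

/-! ### §3 Translates of a local observable under the box state -/

/-- **Interior translates**: for `E ∈ 𝔄_{Λ'}` and `v` with `Λ' + v ⊆ [0,L)^d`, the torus translate
`T_{v mod L} Γ(ι_{Λ'}) E` has box-state expectation `(ω ∘ τ_v)(E)` (pull-back of the translated region is
the torus translate of the pull-back, then the defining property). [cite: BratteliRobinsonII1997, §6.2.2] -/
theorem boxState_relabel_translate_fermionEmbed {Λ' : Finset (Site d)}
    (hInj : Set.InjOn (Torus.proj (d := d) L) ↑Λ') (E : FermionOp Λ') {v : Site d}
    (hv : shiftSet v Λ' ⊆ halfOpenBox d L) :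
    ω.boxState L (relabel (Orb.translate (Torus.proj L v)) (fermionEmbed (PolySite.toTorusEmb L hInj) E)) =
      (ω.shift v).expect Λ' E := by
  have h' : Set.InjOn (Torus.proj (d := d) L) ↑(shiftSet v Λ') :=
    (injOn_proj_halfOpenBox (d := d) L).mono (by exact_mod_cast hv)
  rw [← fermionEmbed_toTorusEmb_shiftEmb L v hInj h' E, ω.boxState_fermionEmbed_toTorusEmb L hv h',
    InfVolFermionState.shift_expect]

/-- Interior translates under a TRANSLATION-INVARIANT state all have expectation `ω(E)`.
[cite: BratteliRobinsonII1997, §6.2.2] -/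
theorem boxState_relabel_translate_fermionEmbed_of_isTranslationInvariant {ω : InfVolFermionState d}
    (hω : ω.IsTranslationInvariant) {Λ' : Finset (Site d)} (hInj : Set.InjOn (Torus.proj (d := d) L) ↑Λ')
    (E : FermionOp Λ') {v : Site d} (hv : shiftSet v Λ' ⊆ halfOpenBox d L) :
    ω.boxState L (relabel (Orb.translate (Torus.proj L v)) (fermionEmbed (PolySite.toTorusEmb L hInj) E)) =
      ω.expect Λ' E := by
  rw [ω.boxState_relabel_translate_fermionEmbed L hInj E hv, hω v]

/-- **Every translate is squeezed by positivity**: for Hermitian `E`,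
`E₀(E) ≤ Re φ_L(T_w Γ(ι_{Λ'}) E) ≤ −E₀(−E)` for every torus translation `w` (the spectrum of `E` is
preserved by the `*`-homomorphisms `Γ`, `T_w`; here via the variational principle for the Hermitian matrices
`T_w Γ(E) − E₀(E)·𝟙 = T_w Γ(Cᴴ C)`). [cite: Tasaki2020, §2.1] -/
theorem re_boxState_relabel_translate_fermionEmbed_mem_Icc {Λ' : Finset (Site d)}
    (hInj : Set.InjOn (Torus.proj (d := d) L) ↑Λ') {E : FermionOp Λ'} (hE : E.IsHermitian) (w : TorusSite d L) :
    (ω.boxState L (relabel (Orb.translate w) (fermionEmbed (PolySite.toTorusEmb L hInj) E))).re ∈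
      Set.Icc E.groundEnergy (-(-E).groundEnergy) := by
  -- generic: for a state `φ` of the torus algebra and `c•1 - E = Cᴴ C`, `Re φ(T_w Γ E) ≤ c`
  have key : ∀ {F : FermionOp Λ'} (_ : F.IsHermitian),
      (ω.boxState L (relabel (Orb.translate w) (fermionEmbed (PolySite.toTorusEmb L hInj) F))).re ≤
        -(-F).groundEnergy := by
    intro F hF
    have hpsd : ((((-(-F).groundEnergy : ℝ)) : ℂ) • (1 : FermionOp Λ') - F).PosSemidef := by
      have h := posSemidef_sub_groundEnergy hF.neg
      rw [Algebra.algebraMap_eq_smul_one, ← Complex.coe_smul] at h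
      have heq : (((-(-F).groundEnergy : ℝ)) : ℂ) • (1 : FermionOp Λ') - F =
          -F - (((-F).groundEnergy : ℝ) : ℂ) • (1 : FermionOp Λ') := by
        rw [Complex.ofReal_neg, neg_smul]; abel
      rw [heq]; exact h
    obtain ⟨C, hC⟩ := (CStarAlgebra.nonneg_iff_eq_star_mul_self (A := FermionOp Λ')).mp hpsd.nonneg
    rw [Matrix.star_eq_conjTranspose] at hC
    have hY : relabel (Orb.translate w) (fermionEmbed (PolySite.toTorusEmb L hInj)
          ((((-(-F).groundEnergy : ℝ)) : ℂ) • (1 : FermionOp Λ') - F)) =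
        (relabel (Orb.translate w) (fermionEmbed (PolySite.toTorusEmb L hInj) C))ᴴ *
          relabel (Orb.translate w) (fermionEmbed (PolySite.toTorusEmb L hInj) C) := by
      rw [hC, fermionEmbed_mul, fermionEmbed_conjTranspose, relabel_mul, relabel_conjTranspose]
    have hpos := ω.boxState_nonneg L (relabel (Orb.translate w) (fermionEmbed (PolySite.toTorusEmb L hInj) C))
    have hone : relabel (Orb.translate w) (fermionEmbed (PolySite.toTorusEmb L hInj) (1 : FermionOp Λ')) =
        (1 : Matrix (Finset (Orb (FermionTorus d L))) (Finset (Orb (FermionTorus d L))) ℂ) := by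
      rw [fermionEmbed_one, relabel_one']
      ext a b
      simp only [Matrix.one_apply]
      by_cases h : a = b
      · rw [if_pos h, if_pos h]
      · rw [if_neg h, if_neg h]
    rw [← hY, fermionEmbed_sub, fermionEmbed_smul, relabel_sub, relabel_smul, hone, map_sub,
      LinearMap.map_smul, ω.boxState_one L] at hpos
    obtain ⟨hre, -⟩ := Complex.nonneg_iff.mp hpos
    simp only [Complex.sub_re, smul_eq_mul, mul_one, Complex.ofReal_re] at hre
    linarith
  refine ⟨?_, key hE⟩
  have h := key hE.neg
  rw [neg_neg, fermionEmbed_neg, relabel_neg', map_neg, Complex.neg_re] at h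
  linarith

/-! ### §4 The periodised Hamiltonian under the box state -/

/-- Counting the interior: for `Λ' ⊆ [−R, R]^d` and `2R ≤ L`, at least `(L − 2R)^d` translates
`v ∈ [0, L)^d` have `Λ' + v ⊆ [0, L)^d` — the surface count behind the `O(L^{d-1})` boundary terms of the
periodic-box thermodynamic limit (public form of the count used in `TorusGroundEnergyDensityLimit.lean` §3).
[cite: BratteliRobinsonII1997, §6.2.2] -/
theorem pow_sub_le_card_filter_shiftSet_subset_halfOpenBox {L : ℕ} {Λ' : Finset (Site d)} {R : ℕ}
    (hR : ∀ x ∈ Λ', ∀ i, |x i| ≤ R) (h2R : 2 * R ≤ L) :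
    (L - 2 * R) ^ d ≤ ((halfOpenBox d L).filter fun v => shiftSet v Λ' ⊆ halfOpenBox d L).card := by
  classical
  set r : Site d := fun _ => (R : ℤ) with hr
  have hinj : Set.InjOn (fun u : Site d => u + r) ↑(halfOpenBox d (L - 2 * R)) :=
    fun a _ b _ hab => add_right_cancel hab
  rw [← card_halfOpenBox d (L - 2 * R), ← Finset.card_image_of_injOn hinj]
  refine Finset.card_le_card fun v hv => ?_
  rw [Finset.mem_image] at hv
  obtain ⟨u, hu, rfl⟩ := hv
  rw [mem_halfOpenBox] at hu
  have hcast : ((L - 2 * R : ℕ) : ℤ) = (L : ℤ) - 2 * R := by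
    rw [Nat.cast_sub h2R]; push_cast; ring
  rw [Finset.mem_filter, mem_halfOpenBox]
  refine ⟨fun i => ?_, fun y hy => ?_⟩
  · have h := hu i
    rw [hcast] at h
    simp only [Pi.add_apply, hr]
    constructor <;> linarith [h.1, h.2]
  · rw [mem_shiftSet] at hy
    have hx := hR _ hy
    rw [mem_halfOpenBox]
    intro i
    have h1 := hx i
    have h2 := hu i
    rw [hcast] at h2
    rw [abs_le] at h1
    simp only [Pi.sub_apply, Pi.add_apply, hr] at h1
    constructor <;> linarith [h1.1, h1.2, h2.1, h2.2]

/-- The wrapped translates are few: `#{v ∈ [0,L)^d : ¬ Λ' + v ⊆ [0,L)^d} ≤ L^d − (L − 2R)^d` (real form) —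
the `O(L^{d-1})` surface terms of the periodic-box limit. [cite: BratteliRobinsonII1997, §6.2.2] -/
theorem card_filter_not_shiftSet_subset_halfOpenBox_le {L : ℕ} {Λ' : Finset (Site d)} {R : ℕ}
    (hR : ∀ x ∈ Λ', ∀ i, |x i| ≤ R) (h2R : 2 * R ≤ L) :
    ((((halfOpenBox d L).filter fun v => ¬ shiftSet v Λ' ⊆ halfOpenBox d L).card : ℕ) : ℝ) ≤
      (L : ℝ) ^ d - ((L - 2 * R : ℕ) : ℝ) ^ d := by
  have h := Finset.card_filter_add_card_filter_not (s := halfOpenBox d L)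
    (p := fun v => shiftSet v Λ' ⊆ halfOpenBox d L)
  rw [card_halfOpenBox] at h
  have hI : ((L - 2 * R : ℕ) : ℝ) ^ d ≤
      ((((halfOpenBox d L).filter fun v => shiftSet v Λ' ⊆ halfOpenBox d L).card : ℕ) : ℝ) := by
    exact_mod_cast pow_sub_le_card_filter_shiftSet_subset_halfOpenBox (d := d) hR h2R
  have h' : ((((halfOpenBox d L).filter fun v => shiftSet v Λ' ⊆ halfOpenBox d L).card : ℕ) : ℝ) +
      ((((halfOpenBox d L).filter fun v => ¬ shiftSet v Λ' ⊆ halfOpenBox d L).card : ℕ) : ℝ) = (L : ℝ) ^ d := by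
    exact_mod_cast h
  linarith

/-- The torus sum of a function of `v mod L` is the box sum. [cite: FriedliVelenik2017, §3.1] -/
theorem sum_univ_torus_eq_sum_halfOpenBox {M : Type*} [AddCommMonoid M] (L : ℕ) [NeZero L]
    (F : TorusSite d L → M) : ∑ w : TorusSite d L, F w = ∑ v ∈ halfOpenBox d L, F (Torus.proj L v) := by
  have himage : (Finset.univ : Finset (TorusSite d L)) = (halfOpenBox d L).image (Torus.proj L) := by
    refine (Finset.eq_univ_iff_forall.2 fun x => ?_).symm
    obtain ⟨y, hy, hyx⟩ := (torusProj_bijOn_halfOpenBox (d := d) L).surjOn (Set.mem_univ x)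
    exact Finset.mem_image.2 ⟨y, hy, hyx⟩
  rw [himage, Finset.sum_image (fun a ha b hb hab => injOn_proj_halfOpenBox (d := d) L ha hb hab)]

/-- **THE PERIODISED HAMILTONIAN UNDER THE BOX STATE (two-sided)**: for a translation-invariant `ω`, a
Hermitian `E ∈ 𝔄_{Λ'}` with `Λ' ⊆ [−R,R]^d`, `2R ≤ L`, and `H = Σ_v T_v Γ(E) T_v⁻¹`,
`|Re φ_L(H) − L^d · Re ω(E)| ≤ (L^d − (L − 2R)^d) · (−E₀(−E) − E₀(E))`: the `≥ (L − 2R)^d` interior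
translates contribute `ω(E)` each, every translate lies in `[E₀(E), −E₀(−E)] ∋ Re ω(E)`.
[cite: BratteliRobinsonII1997, §6.2.2] -/
theorem abs_re_boxState_sub_pow_mul_re_expect_le {ω : InfVolFermionState d} (hω : ω.IsTranslationInvariant)
    {Λ' : Finset (Site d)} (hInj : Set.InjOn (Torus.proj (d := d) L) ↑Λ') {E : FermionOp Λ'} (hE : E.IsHermitian)
    {R : ℕ} (hR : ∀ x ∈ Λ', ∀ i, |x i| ≤ R) (h2R : 2 * R ≤ L)
    {H : Matrix (Finset (Orb (FermionTorus d L))) (Finset (Orb (FermionTorus d L))) ℂ}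
    (hH : ∑ v : TorusSite d L, relabel (Orb.translate v) (fermionEmbed (PolySite.toTorusEmb L hInj) E) = H) :
    |(ω.boxState L H).re - (L : ℝ) ^ d * (ω.expect Λ' E).re| ≤
      ((L : ℝ) ^ d - ((L - 2 * R : ℕ) : ℝ) ^ d) * (-(-E).groundEnergy - E.groundEnergy) := by
  classical
  set c : ℝ := -(-E).groundEnergy with hc
  set e : ℝ := (ω.expect Λ' E).re with he
  set T : Site d → ℝ := fun v =>
    (ω.boxState L (relabel (Orb.translate (Torus.proj L v)) (fermionEmbed (PolySite.toTorusEmb L hInj) E))).re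
    with hT
  have hTmem : ∀ v, T v ∈ Set.Icc E.groundEnergy c := fun v =>
    ω.re_boxState_relabel_translate_fermionEmbed_mem_Icc L hInj hE (Torus.proj L v)
  have hTint : ∀ v, shiftSet v Λ' ⊆ halfOpenBox d L → T v = e := fun v hv => by
    simp only [hT]
    rw [boxState_relabel_translate_fermionEmbed_of_isTranslationInvariant L hω hInj E hv]
  have hec : e ≤ c := ω.re_expect_le_neg_groundEnergy_neg Λ' hE
  have hE0e : E.groundEnergy ≤ e := ω.groundEnergy_le_re_expect Λ' hE
  -- `Re φ(H) = Σ_{v ∈ box} T v`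
  have hsum : (ω.boxState L H).re = ∑ v ∈ halfOpenBox d L, T v := by
    rw [← hH, map_sum, Complex.re_sum, sum_univ_torus_eq_sum_halfOpenBox]
  rw [hsum, ← Finset.sum_filter_add_sum_filter_not (halfOpenBox d L) (fun v => shiftSet v Λ' ⊆ halfOpenBox d L)]
  set I := (halfOpenBox d L).filter fun v => shiftSet v Λ' ⊆ halfOpenBox d L with hI
  set J := (halfOpenBox d L).filter fun v => ¬ shiftSet v Λ' ⊆ halfOpenBox d L with hJ
  have hIsum : ∑ v ∈ I, T v = (I.card : ℝ) * e := by
    rw [Finset.sum_congr rfl fun v hv => hTint v (Finset.mem_filter.1 hv).2, Finset.sum_const, nsmul_eq_mul]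
  have hJle : ∑ v ∈ J, T v ≤ (J.card : ℝ) * c := by
    have := Finset.sum_le_sum fun v (_ : v ∈ J) => (hTmem v).2
    rwa [Finset.sum_const, nsmul_eq_mul] at this
  have hJge : (J.card : ℝ) * E.groundEnergy ≤ ∑ v ∈ J, T v := by
    have := Finset.sum_le_sum fun v (_ : v ∈ J) => (hTmem v).1
    rwa [Finset.sum_const, nsmul_eq_mul] at this
  have hcardIJ : (I.card : ℝ) + J.card = (L : ℝ) ^ d := by
    have h := Finset.card_filter_add_card_filter_not (s := halfOpenBox d L)
      (p := fun v => shiftSet v Λ' ⊆ halfOpenBox d L)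
    rw [card_halfOpenBox] at h
    exact_mod_cast h
  have hJcard : (J.card : ℝ) ≤ (L : ℝ) ^ d - ((L - 2 * R : ℕ) : ℝ) ^ d :=
    card_filter_not_shiftSet_subset_halfOpenBox_le (d := d) hR h2R
  have hJ0 : (0 : ℝ) ≤ J.card := Nat.cast_nonneg _
  have hIe : (I.card : ℝ) * e = (L : ℝ) ^ d * e - (J.card : ℝ) * e := by rw [← hcardIJ]; ring
  have hbd : ((L - 2 * R : ℕ) : ℝ) ^ d ≤ (L : ℝ) ^ d := by linarith
  rw [hIsum, hIe, abs_le]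
  constructor
  · -- lower: `Σ ≥ (L^d − J) e + J E₀(E) = L^d e − J (e − E₀ E)`
    have h1 : (J.card : ℝ) * (e - E.groundEnergy) ≤
        ((L : ℝ) ^ d - ((L - 2 * R : ℕ) : ℝ) ^ d) * (c - E.groundEnergy) :=
      calc (J.card : ℝ) * (e - E.groundEnergy)
          ≤ ((L : ℝ) ^ d - ((L - 2 * R : ℕ) : ℝ) ^ d) * (e - E.groundEnergy) :=
            mul_le_mul_of_nonneg_right hJcard (by linarith)
        _ ≤ ((L : ℝ) ^ d - ((L - 2 * R : ℕ) : ℝ) ^ d) * (c - E.groundEnergy) :=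
            mul_le_mul_of_nonneg_left (by linarith) (by linarith)
    have h1' : (J.card : ℝ) * e - (J.card : ℝ) * E.groundEnergy ≤
        ((L : ℝ) ^ d - ((L - 2 * R : ℕ) : ℝ) ^ d) * (c - E.groundEnergy) := by rw [← mul_sub]; exact h1
    linarith [h1', hJge]
  · -- upper: `Σ ≤ (L^d − J) e + J c = L^d e + J (c − e)`
    have h1 : (J.card : ℝ) * (c - e) ≤ ((L : ℝ) ^ d - ((L - 2 * R : ℕ) : ℝ) ^ d) * (c - E.groundEnergy) :=
      calc (J.card : ℝ) * (c - e) ≤ ((L : ℝ) ^ d - ((L - 2 * R : ℕ) : ℝ) ^ d) * (c - e) :=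
            mul_le_mul_of_nonneg_right hJcard (by linarith)
        _ ≤ ((L : ℝ) ^ d - ((L - 2 * R : ℕ) : ℝ) ^ d) * (c - E.groundEnergy) :=
            mul_le_mul_of_nonneg_left (by linarith) (by linarith)
    have h1' : (J.card : ℝ) * c - (J.card : ℝ) * e ≤
        ((L : ℝ) ^ d - ((L - 2 * R : ℕ) : ℝ) ^ d) * (c - E.groundEnergy) := by rw [← mul_sub]; exact h1
    linarith [h1', hJle]

/-- **Upper half** (the form the approximating-Hamiltonian chain consumes):
`Re φ_L(H) ≤ L^d · Re ω(E) + (L^d − (L − 2R)^d) · (−E₀(−E) − E₀(E))`. [cite: BratteliRobinsonII1997, §6.2.2] -/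
theorem re_boxState_le_pow_mul_re_expect_add {ω : InfVolFermionState d} (hω : ω.IsTranslationInvariant)
    {Λ' : Finset (Site d)} (hInj : Set.InjOn (Torus.proj (d := d) L) ↑Λ') {E : FermionOp Λ'} (hE : E.IsHermitian)
    {R : ℕ} (hR : ∀ x ∈ Λ', ∀ i, |x i| ≤ R) (h2R : 2 * R ≤ L)
    {H : Matrix (Finset (Orb (FermionTorus d L))) (Finset (Orb (FermionTorus d L))) ℂ}
    (hH : ∑ v : TorusSite d L, relabel (Orb.translate v) (fermionEmbed (PolySite.toTorusEmb L hInj) E) = H) :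
    (ω.boxState L H).re ≤ (L : ℝ) ^ d * (ω.expect Λ' E).re +
      ((L : ℝ) ^ d - ((L - 2 * R : ℕ) : ℝ) ^ d) * (-(-E).groundEnergy - E.groundEnergy) := by
  have h := abs_le.1 (abs_re_boxState_sub_pow_mul_re_expect_le L hω hInj hE hR h2R hH)
  linarith [h.2]

/-- **Lower half**: `L^d · Re ω(E) − (L^d − (L − 2R)^d) · (−E₀(−E) − E₀(E)) ≤ Re φ_L(H)`.
[cite: BratteliRobinsonII1997, §6.2.2] -/
theorem pow_mul_re_expect_sub_le_re_boxState {ω : InfVolFermionState d} (hω : ω.IsTranslationInvariant)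
    {Λ' : Finset (Site d)} (hInj : Set.InjOn (Torus.proj (d := d) L) ↑Λ') {E : FermionOp Λ'} (hE : E.IsHermitian)
    {R : ℕ} (hR : ∀ x ∈ Λ', ∀ i, |x i| ≤ R) (h2R : 2 * R ≤ L)
    {H : Matrix (Finset (Orb (FermionTorus d L))) (Finset (Orb (FermionTorus d L))) ℂ}
    (hH : ∑ v : TorusSite d L, relabel (Orb.translate v) (fermionEmbed (PolySite.toTorusEmb L hInj) E) = H) :
    (L : ℝ) ^ d * (ω.expect Λ' E).re -
        ((L : ℝ) ^ d - ((L - 2 * R : ℕ) : ℝ) ^ d) * (-(-E).groundEnergy - E.groundEnergy) ≤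
      (ω.boxState L H).re := by
  have h := abs_le.1 (abs_re_boxState_sub_pow_mul_re_expect_le L hω hInj hE hR h2R hH)
  linarith [h.1]

end InfVolFermionState

end BoxState

end Literature.MathematicalPhysics.QuantumLattice

end
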